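import Literature.MathematicalPhysics.QuantumLattice.XYStabilityTransfer
import Literature.MathematicalPhysics.QuantumLattice.XYZGroundStateOrderIntegral
import HarnessLib

/-!
# A certified numerical window for the KLS stability-transfer threshold `klsKappa₀`

Topic `MathematicalPhysics/QuantumLattice`; theorem-only companion of `XYStabilityTransfer.lean`
(Kennedy–Lieb–Shastry transfer for the perturbed spin-½ quantum XY model on `ℤ²`: the conditional
theorem `tracialLRO_of_uniformMeanGDn` holds for every `κ` with `0 ≤ κ < klsKappa₀`,
`klsKappa₀ := 1/(2 I(2)²) − 1`, `I(2) = klsIntegral 2` the KLS lattice integral of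
[KLS1988PRL, eq. (8)], numerically `I(2) = 0.65` there and `Ĩ⁽²⁾ = 0.6468` in
[BjornbergUeltschi2022, Table 1], so `klsKappa₀ ≈ 0.195`). No statement of the tree is changed and
no named fact is introduced.

That module's docstring records the in-tree certificate `klsKappa₀ ≥ π²/9 − 1 ≈ 0.0966` (from the
majorant `I(2) ≤ 3√2/(2π)`, `lintegral_klsIntegrand_two_le`) only as a remark, and the remark tacitly
assumes `I(2) > 0` (with Lean's `1/0 = 0`, `I(2) = 0` would give `klsKappa₀ = −1` and an empty
hypothesis range). This file makes the window a theorem: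

* `klsIntegral_two_pos : 0 < klsIntegral 2` (the integrand is `≥ 1/2` on `[π/6, π/3]²`);
* `klsIntegral_two_le_sharp : klsIntegral 2 ≤ 15√2/64 + 1/π` (`= 0.64976…`), transporting the
  tree's sharper Lebesgue-integral majorant `lintegral_klsIntegrand_two_le_sharp`
  (`XYZGroundStateOrderIntegral.lean`, proved there for the Björnberg–Ueltschi planar window) to the
  real-valued `klsIntegral`, exactly as `klsIntegral_two_le_holds` transports the cruder one;
* `klsKappa₀_gt : 0.184 < klsKappa₀` and `klsKappa₀_pos : 0 < klsKappa₀` (with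
  `kls_sharp_const_lt : 15√2/64 + 1/π < 0.64978`).

So the hypothesis range of `tracialLRO_of_uniformMeanGDn` contains `[0, 0.184]`; in particular the
unconditional instance `κ = 0` (Gaussian domination at `W = 0`) lies inside it.

## References

* T. Kennedy, E. H. Lieb, B. S. Shastry, *The XY model has long-range order for all spins and all
  dimensions greater than one*, Phys. Rev. Lett. 61 (1988) 2582–2584, eqs. (7)–(8) (the integral
  `I(2)` and the criterion). [KLS1988PRL]
* J. E. Björnberg, D. Ueltschi, *Reflection positivity and infrared bounds for quantum spin
  systems* (2022), Table 1 (`Ĩ⁽²⁾ = 0.6468`). [BjornbergUeltschi2022]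

## Mathlib and tree

Mathlib: `integral_eq_lintegral_of_nonneg_ae`, `lintegral_mono_set`, `setLIntegral_mono`,
`setLIntegral_const`, `volume_pi_pi`, `Real.volume_Icc`, `ENNReal.toReal_mono`,
`Real.cos_le_cos_of_nonneg_of_le_pi`, `Real.cos_pi_div_three`, `Real.cos_pi_div_six`,
`Real.one_le_sqrt`, `one_div_lt_one_div_of_lt`, `pow_lt_pow_left₀`. Tree: `klsIntegral`,
`klsIntegrand`, `klsIntegrand_nonneg` (`XYOrderProofs.lean`), `measurable_klsIntegrand`,
`lintegral_klsIntegrand_two_le` (`XYOrderIntegralProofs.lean`), `lintegral_klsIntegrand_two_le_sharp`,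
`kls_sharp_const_lt` (`XYZGroundStateOrderIntegral.lean`), `klsKappa₀` (`XYStabilityTransfer.lean`).
-/

noncomputable section

open MeasureTheory Set Filter Topology
open scoped ENNReal
open Literature.MathematicalPhysics.QuantumLattice

namespace Literature.MathematicalPhysics.QuantumLattice.XYStabilityTransfer

section Threshold

/-- **`I(2) ≤ 15√2/64 + 1/π = 0.64976…`** for the KLS integral `klsIntegral 2`: the tree's sharper
Lebesgue-integral majorant `lintegral_klsIntegrand_two_le_sharp` (`XYZGroundStateOrderIntegral.lean`,
after Björnberg–Ueltschi's `Ĩ⁽²⁾ = 0.6468`) transported to the real-valued integral, exactly as the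
tree's `klsIntegral_two_le_holds` transports the cruder `3√2/(2π)`.
[cite: KLS1988PRL, eq. (8)] [cite: BjornbergUeltschi2022, Table 1] -/
theorem klsIntegral_two_le_sharp : klsIntegral 2 ≤ 15 * Real.sqrt 2 / 64 + 1 / Real.pi := by
  unfold klsIntegral
  rw [integral_eq_lintegral_of_nonneg_ae (Eventually.of_forall (klsIntegrand_nonneg 2))
    (measurable_klsIntegrand 2).aestronglyMeasurable]
  have htr := ENNReal.toReal_le_of_le_ofReal (by positivity) lintegral_klsIntegrand_two_le_sharp
  have hπ : (0 : ℝ) < (2 * Real.pi) ^ 2 := by positivity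
  refine (div_le_div_of_nonneg_right htr hπ.le).trans (le_of_eq ?_)
  have hπ0 : Real.pi ≠ 0 := Real.pi_pos.ne'
  field_simp
  ring

/-- On the box `[π/6, π/3]²` the KLS integrand is at least `1/2`: there `1/2 ≤ cos pᵢ ≤ √3/2 < 1`, so
`(cos p₁ + cos p₂)/2 ≥ 1/2` and `(2 + cos p₁ + cos p₂)/(2 − cos p₁ − cos p₂) ≥ 1`. [folklore] -/
private theorem klsIntegrand_two_ge_half {p : Fin 2 → ℝ}
    (hp : ∀ i, p i ∈ Icc (Real.pi / 6) (Real.pi / 3)) : 1 / 2 ≤ klsIntegrand 2 p := by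
  have hcos : ∀ i, 1 / 2 ≤ Real.cos (p i) ∧ Real.cos (p i) ≤ Real.sqrt 3 / 2 := by
    intro i
    obtain ⟨h1, h2⟩ := hp i
    constructor
    · rw [← Real.cos_pi_div_three]
      exact Real.cos_le_cos_of_nonneg_of_le_pi (by linarith [Real.pi_pos])
        (by linarith [Real.pi_pos]) h2
    · rw [← Real.cos_pi_div_six]
      exact Real.cos_le_cos_of_nonneg_of_le_pi (by linarith [Real.pi_pos])
        (by linarith [Real.pi_pos]) h1
  have hs3 : Real.sqrt 3 / 2 < 1 := by
    rw [div_lt_one (by norm_num : (0:ℝ) < 2), Real.sqrt_lt' (by norm_num)]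
    norm_num
  obtain ⟨h0l, h0u⟩ := hcos 0
  obtain ⟨h1l, h1u⟩ := hcos 1
  unfold klsIntegrand
  simp only [Fin.sum_univ_two]
  have hden : 0 < (1 - Real.cos (p 0)) + (1 - Real.cos (p 1)) := by linarith
  have hratio : 1 ≤ ((1 + Real.cos (p 0)) + (1 + Real.cos (p 1))) /
      ((1 - Real.cos (p 0)) + (1 - Real.cos (p 1))) := by
    rw [le_div_iff₀ hden]
    linarith
  have hsqrt : 1 ≤ Real.sqrt (((1 + Real.cos (p 0)) + (1 + Real.cos (p 1))) /
      ((1 - Real.cos (p 0)) + (1 - Real.cos (p 1)))) := Real.one_le_sqrt.mpr hratio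
  have hmax : 1 / 2 ≤ max ((Real.cos (p 0) + Real.cos (p 1)) / ((2 : ℕ) : ℝ)) 0 := by
    refine le_trans ?_ (le_max_left _ _)
    rw [Nat.cast_ofNat, le_div_iff₀ (by norm_num : (0:ℝ) < 2)]
    linarith
  calc (1 : ℝ) / 2 = 1 * (1 / 2) := by ring
    _ ≤ _ := mul_le_mul hsqrt hmax (by norm_num) (le_trans zero_le_one hsqrt)

/-- **`I(2) > 0`** (indeed `I(2) ≥ (π/6)²/(2(2π)²) = 1/288`): the integrand is `≥ 1/2` on the box
`[π/6, π/3]² ⊆ [-π, π]²`. Needed so that `κ₀ = 1/(2 I(2)²) − 1` is a decreasing function of the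
majorant (Lean's `1/0 = 0` would otherwise give `κ₀ = −1`). The statement is about the printed
integral `I(2)` of [KLS1988PRL, eq. (8)] (value `0.65` there; `0.6468` in [BjornbergUeltschi2022,
Table 1]). [cite: KLS1988PRL, eq. (8)] -/
theorem klsIntegral_two_pos : 0 < klsIntegral 2 := by
  unfold klsIntegral
  rw [integral_eq_lintegral_of_nonneg_ae (Eventually.of_forall (klsIntegrand_nonneg 2))
    (measurable_klsIntegrand 2).aestronglyMeasurable]
  refine div_pos ?_ (by positivity)
  -- the sub-box
  set S : Set (Fin 2 → ℝ) := Set.pi univ fun _ : Fin 2 => Icc (Real.pi / 6) (Real.pi / 3) with hS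
  have hSsub : S ⊆ Set.pi univ (fun _ : Fin 2 => Icc (-Real.pi) Real.pi) := by
    intro p hp
    simp only [hS, Set.mem_pi, Set.mem_univ, forall_const, Set.mem_Icc] at hp ⊢
    intro i
    obtain ⟨h1, h2⟩ := hp i
    constructor <;> linarith [Real.pi_pos]
  have hvolS : volume S = ENNReal.ofReal (Real.pi / 6) ^ 2 := by
    rw [hS, volume_pi_pi]
    simp only [Real.volume_Icc, Finset.prod_const, Finset.card_univ, Fintype.card_fin]
    congr 1
    congr 1
    ring
  -- lower bound on the sub-box
  have hlow : ENNReal.ofReal (1 / 2) * volume S ≤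
      ∫⁻ p in S, ENNReal.ofReal (klsIntegrand 2 p) := by
    rw [← setLIntegral_const]
    refine setLIntegral_mono ((measurable_klsIntegrand 2).ennreal_ofReal) fun p hp => ?_
    refine ENNReal.ofReal_le_ofReal (klsIntegrand_two_ge_half fun i => ?_)
    simp only [hS, Set.mem_pi, Set.mem_univ, forall_const] at hp
    exact hp i
  have hmono : ∫⁻ p in S, ENNReal.ofReal (klsIntegrand 2 p) ≤
      ∫⁻ p in Set.pi univ (fun _ : Fin 2 => Icc (-Real.pi) Real.pi),
        ENNReal.ofReal (klsIntegrand 2 p) := lintegral_mono_set hSsub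
  have hfin : ∫⁻ p in Set.pi univ (fun _ : Fin 2 => Icc (-Real.pi) Real.pi),
      ENNReal.ofReal (klsIntegrand 2 p) ≠ ⊤ :=
    ne_top_of_le_ne_top ENNReal.ofReal_ne_top lintegral_klsIntegrand_two_le
  have hposS : 0 < (ENNReal.ofReal (1 / 2) * volume S).toReal := by
    rw [hvolS, ENNReal.toReal_mul, ENNReal.toReal_pow, ENNReal.toReal_ofReal (by norm_num),
      ENNReal.toReal_ofReal (by positivity)]
    positivity
  exact hposS.trans_le (ENNReal.toReal_mono hfin (hlow.trans hmono))

/-- **Certified window for the KLS stability-transfer threshold: `0.184 < klsKappa₀`**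
(`klsKappa₀ = 1/(2 I(2)²) − 1 ≈ 0.195` at `I(2) = 0.6468`); from `klsIntegral_two_le_sharp`,
`kls_sharp_const_lt` (`15√2/64 + 1/π < 0.64978`) and `klsIntegral_two_pos`. This supersedes the
module docstring's `≥ π²/9 − 1 ≈ 0.0966` (from the cruder `I(2) ≤ 3√2/(2π)`) and makes the
non-vacuity of the hypothesis range `0 ≤ κ < klsKappa₀` of `tracialLRO_of_uniformMeanGDn` a theorem
rather than a docstring remark. [cite: KLS1988PRL, eqs. (7)–(8)] [cite: BjornbergUeltschi2022, Table 1] -/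
theorem klsKappa₀_gt : (0.184 : ℝ) < klsKappa₀ := by
  unfold klsKappa₀
  have hI := klsIntegral_two_le_sharp
  have hc := kls_sharp_const_lt
  have hI0 := klsIntegral_two_pos
  have hIc : klsIntegral 2 < 0.64978 := hI.trans_lt hc
  have hsq : klsIntegral 2 ^ 2 < 0.64978 ^ 2 := by
    exact pow_lt_pow_left₀ hIc hI0.le two_ne_zero
  have h2sq : 0 < 2 * klsIntegral 2 ^ 2 := by positivity
  have hinv : 1 / (2 * (0.64978 : ℝ) ^ 2) < 1 / (2 * klsIntegral 2 ^ 2) :=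
    one_div_lt_one_div_of_lt h2sq (by linarith)
  have hnum : (1.184 : ℝ) < 1 / (2 * (0.64978 : ℝ) ^ 2) := by
    rw [lt_div_iff₀ (by norm_num)]
    norm_num
  linarith

/-- In particular the threshold is positive and the unconditional instance `κ = 0` (Gaussian
domination at `W = 0`) lies inside the window. [cite: KLS1988PRL, eqs. (7)–(8)] -/
theorem klsKappa₀_pos : 0 < klsKappa₀ := lt_trans (by norm_num) klsKappa₀_gt

end Threshold

end Literature.MathematicalPhysics.QuantumLattice.XYStabilityTransfer

end
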